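import Summits.CriticalPhenomena.Ising3DConformalLimit.Theorems.ReflectionTwinTwinThresholdPlaneSummableRenewalStates
import HarnessLib

/-!
# Crux `TwinThreshold` (stmt-CriticalPhenomena-16906), line `seam_renewal` — stub `stub_planeSummable_of_surfaceSummable` ((W2) seam renewal: finite surface susceptibility implies finite plane susceptibility at weak seam)

Registered stub of the checked skeleton `Cruxes/TwinThreshold/Lines/seam_renewal.lean`, proved EXACTLY as registered
(`--supports stmt-CriticalPhenomena-16906`); parts I–III of the proof are `ReflectionTwinTwinThresholdPlaneSummableRenewalLemmas.lean`,
`…RenewalBounds.lean`, `…RenewalStates.lean`. Here: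

* `Gs_mono_succ` — GKS II in the volume for the box pair function at lattice sites (the `Λ_L` model is the `Λ_{L+1}` model with the
  shell couplings switched off: `EndpointIdentityProof.gibbsAvg_restrict` + Griffiths' comparison `TwoCouplingGKS.gibbsAvg_spinProduct_mono`,
  the pattern of `TwoCouplingGKS.boxAvg_mono_volume`), hence `tendsto_Gs`: the sup over boxes `twinLat J 2 ![x, y]` is the limit of the
  box pair functions; `sum_Gs_le_Ssum` compares a finite plane sum with the full plane sum of the box;
* `planeSummable_of_surfaceSummable` — `J₀ = 1 / (12 β_c(3) max(C,1))`, `C' = 3`: `Ssum_le_three` in every box and passage to the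
  limit in finite sums; and the registered statement `stub_planeSummable_of_surfaceSummable`, by definitional unfolding.

Sources: Aizenman–Duminil-Copin (2021) Lemma 5.7; Simon / Lieb (1980); Friedli–Velenik (2017) §3.6–3.8 (GKS, Exercises 3.12, 3.16).
-/

noncomputable section

namespace Summit.CriticalPhenomena.Ising3DConformalLimit.Cruxes.TwinThreshold.SeamRenewal

namespace PlaneSummable

open scoped BigOperators Classical
open Filter Topology Finset
open Literature.Probability.LatticeModels
open Summit.CriticalPhenomena.Ising3DConformalLimit.Cruxes.ExistsScaleCovariantLimit.DecimationHomotopyRate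

/-! ## The box pair function at lattice sites, volume monotonicity, and the sup over boxes -/

/-- Inside the box the two-site box monomial is the pair product. [folklore] -/
theorem boxObs_pair_of_mem {L : ℕ} {x y : Site 3} (hx : x ∈ box 3 L) (hy : y ∈ box 3 L) :
    boxObs L ![x, y] = spinPair (⟨x, hx⟩ : ↥(box 3 L)) ⟨y, hy⟩ := by
  funext s
  simp only [boxObs, Fin.prod_univ_two, Matrix.cons_val_zero, Matrix.cons_val_one, spinPair]
  rw [dif_pos hx, dif_pos hy]

/-- Off the box the two-site box monomial vanishes. [folklore] -/
theorem boxObs_pair_of_not_mem {L : ℕ} {x y : Site 3} (h : ¬ (x ∈ box 3 L ∧ y ∈ box 3 L)) :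
    boxObs L ![x, y] = fun _ => 0 := by
  funext s
  simp only [boxObs, Fin.prod_univ_two, Matrix.cons_val_zero, Matrix.cons_val_one]
  by_cases hx : x ∈ box 3 L
  · rw [dif_neg (fun hy => h ⟨hx, hy⟩), mul_zero]
  · rw [dif_neg hx, zero_mul]

/-- `Gs = Gi` on box sites. [folklore] -/
theorem Gs_eq_Gi {J : ℝ} {L : ℕ} {x y : Site 3} (hx : x ∈ box 3 L) (hy : y ∈ box 3 L) :
    Gs J L x y = Gi J L ⟨x, hx⟩ ⟨y, hy⟩ := by
  unfold Gs Gi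
  rw [boxObs_pair_of_mem hx hy]
  rfl

/-- `Gs = 0` off the box. [folklore] -/
theorem Gs_eq_zero {J : ℝ} {L : ℕ} {x y : Site 3} (h : ¬ (x ∈ box 3 L ∧ y ∈ box 3 L)) : Gs J L x y = 0 := by
  unfold Gs
  rw [boxObs_pair_of_not_mem h]
  exact PairIsing.gibbsAvg_const _ 0

/-- `Gs ≥ 0` (GKS I). [cite: FriedliVelenik2017, Thm. 3.49, eq. (3.54)] -/
theorem Gs_nonneg {J : ℝ} (hJ : 0 ≤ J) {L : ℕ} {x y : Site 3} : 0 ≤ Gs J L x y := by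
  by_cases h : x ∈ box 3 L ∧ y ∈ box 3 L
  · rw [Gs_eq_Gi h.1 h.2]; exact Gi_nonneg hJ L _ _
  · rw [Gs_eq_zero h]

/-- `Gs ≤ 1`. [folklore] -/
theorem Gs_le_one {J : ℝ} (hJ : 0 ≤ J) {L : ℕ} {x y : Site 3} : Gs J L x y ≤ 1 := by
  by_cases h : x ∈ box 3 L ∧ y ∈ box 3 L
  · rw [Gs_eq_Gi h.1 h.2]; exact (PairIsing.avg_spinPair_mem (twinCpl J L) (twinCpl_nonneg hJ L) _ _).2
  · rw [Gs_eq_zero h]; exact zero_le_one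

/-- **GKS II in the volume** for the twin box pair function: `Gs J L x y ≤ Gs J (L+1) x y` (the `Λ_L`-model is the
`Λ_{L+1}`-model with the couplings touching the shell switched off; the shell spins integrate out, and switching the
couplings on is Griffiths' comparison). [cite: FriedliVelenik2017, Exercise 3.12] -/
theorem Gs_mono_succ {J : ℝ} (hJ : 0 ≤ J) (L : ℕ) (x y : Site 3) : Gs J L x y ≤ Gs J (L + 1) x y := by
  by_cases hxy : x ∈ box 3 L ∧ y ∈ box 3 L
  swap
  · rw [Gs_eq_zero hxy]; exact Gs_nonneg hJ
  obtain ⟨hx, hy⟩ := hxy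
  have hx' : x ∈ box 3 (L + 1) := TwoCouplingGKS.box_subset_box_succ L hx
  have hy' : y ∈ box 3 (L + 1) := TwoCouplingGKS.box_subset_box_succ L hy
  have hc := twinCpl_nonneg hJ (L + 1)
  set ct : ↥(box 3 (L + 1)) → ↥(box 3 (L + 1)) → ℝ := fun a b =>
    if a.1 ∈ box 3 L ∧ b.1 ∈ box 3 L then twinCpl J (L + 1) a b else 0 with hct
  -- (1) comparison of couplings on `Λ_{L+1}`
  have hcmp : PairIsing.gibbsAvg ct (boxObs (L + 1) ![x, y]) ≤ Gs J (L + 1) x y := by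
    rw [Gs, boxObs_pair_of_mem hx' hy', spinPair_eq_spinProduct_symmDiff]
    refine TwoCouplingGKS.gibbsAvg_spinProduct_mono (fun a b => ?_) _
    simp only [hct]
    split_ifs
    · exact (abs_of_nonneg (hc a b)).le
    · rw [abs_zero]; exact hc a b
  -- (2) the truncated model marginalises to the `Λ_L`-model
  have hmarg : PairIsing.gibbsAvg ct (boxObs (L + 1) ![x, y]) = Gs J L x y := by
    rw [EndpointIdentityProof.gibbsAvg_restrict (fun a : ↥(box 3 (L + 1)) => a.1 ∈ box 3 L) ct
      (fun a b hab => by simp only [hct]; exact if_neg hab) (boxObs (L + 1) ![x, y])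
      (fun τ => spinAt (⟨⟨x, hx'⟩, hx⟩ : {a : ↥(box 3 (L + 1)) // a.1 ∈ box 3 L}) τ *
        spinAt (⟨⟨y, hy'⟩, hy⟩ : {a : ↥(box 3 (L + 1)) // a.1 ∈ box 3 L}) τ)
      (fun σ => by rw [boxObs_pair_of_mem hx' hy']; rfl)]
    let e : {a : ↥(box 3 (L + 1)) // a.1 ∈ box 3 L} ≃ ↥(box 3 L) :=
      ⟨fun a => ⟨a.1.1, a.2⟩, fun b => ⟨⟨b.1, TwoCouplingGKS.box_subset_box_succ L b.2⟩, b.2⟩,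
        fun _ => rfl, fun _ => rfl⟩
    rw [Gs, ← PairIsing.gibbsAvg_comp_equiv e (twinCpl J L) (boxObs L ![x, y])]
    congr 1
    · funext a b
      simp only [hct]
      rw [if_pos ⟨a.2, b.2⟩]
      rfl
    · funext τ
      rw [boxObs_pair_of_mem hx hy]
      rfl
  rw [← hmarg]
  exact hcmp

/-- The box pair function converges to the sup over boxes `twinLat J 2 ![x, y]` as `L → ∞`.
[cite: FriedliVelenik2017, Exercise 3.16] -/
theorem tendsto_Gs {J : ℝ} (hJ : 0 ≤ J) (x y : Site 3) :
    Tendsto (fun L : ℕ => Gs J L x y) atTop (𝓝 (twinLat J 2 ![x, y])) :=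
  tendsto_atTop_ciSup (monotone_nat_of_le_succ fun L => Gs_mono_succ hJ L x y)
    ⟨1, by rintro _ ⟨L, rfl⟩; exact Gs_le_one hJ⟩

/-- Plane sums over finite sets of plane sites are dominated by the full plane sum of the box. [folklore] -/
theorem sum_Gs_le_Ssum {J : ℝ} (hJ : 0 ≤ J) (L : ℕ) (F : Finset (Site 3)) (hF : ∀ c ∈ F, hh c = 0) :
    ∑ c ∈ F, Gs J L 0 c ≤ Ssum J L ⟨0, zero_mem_box 3 L⟩ := by
  calc ∑ c ∈ F, Gs J L 0 c = ∑ c ∈ F.filter (fun c => c ∈ box 3 L), Gs J L 0 c :=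
        (Finset.sum_filter_of_ne fun c _ hc => by
          by_contra hcb
          exact hc (Gs_eq_zero fun h => hcb h.2)).symm
    _ ≤ ∑ c ∈ (box 3 L).filter (fun c => hh c = 0), Gs J L 0 c :=
        Finset.sum_le_sum_of_subset_of_nonneg
          (fun c hc => by
            rw [Finset.mem_filter] at hc ⊢
            exact ⟨hc.2, hF c hc.1⟩)
          (fun c _ _ => Gs_nonneg hJ)
    _ = ∑ c ∈ box 3 L, (if hh c = 0 then Gs J L 0 c else 0) := Finset.sum_filter _ _
    _ = ∑ z : ↥(box 3 L), (if hh z.1 = 0 then Gs J L 0 z.1 else 0) :=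
        (Finset.sum_coe_sort (box 3 L) (fun c => if hh c = 0 then Gs J L 0 c else 0)).symm
    _ = ∑ z : ↥(box 3 L), (if hh z.1 = 0 then Gi J L ⟨0, zero_mem_box 3 L⟩ z else 0) :=
        Finset.sum_congr rfl fun z _ => by rw [Gs_eq_Gi (zero_mem_box 3 L) z.2]
    _ = Ssum J L ⟨0, zero_mem_box 3 L⟩ := by rw [Ssum, Pl, Finset.sum_filter]

/-! ## The statement -/

/-- **(W2) Seam renewal.** If the critical (111) half-crystal has finite surface susceptibility (hypothesis `(W1)`:
`∑_u halfLat 2 ![v, u] ≤ C` over finite sets of layer-`(-1)` sites `u`, for every layer-`(-1)` base point `v`), then for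
`0 < J ≤ J₀ := 1 / (12 β_c(3) max(C,1))` the plane sums of the weakly sewn twin are bounded: `∑_{c ∈ F} twinLat J 2 ![0, c] ≤ 3`
for every finite set `F` of plane sites. Proof: in each box, Lieb–Simon renewal across the seam (`renewal_site`,
`renewal_half`) with the degree bounds `6 β_c J`, `3 β_c J` and the `(W1)` bound on the restricted half-box states gives
`Ssum ≤ 3` (`Ssum_le_three`); the sup over boxes is a monotone limit (`tendsto_Gs`, GKS II in the volume), and finite sums
pass to the limit. [cite: AizenmanDuminilCopinAnnals2021, Lemma 5.7] -/
theorem planeSummable_of_surfaceSummable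
    (hW1 : ∃ C : ℝ, ∀ v : Site 3, hh v = -1 → ∀ F : Finset (Site 3), (∀ u ∈ F, hh u = -1) →
      ∑ u ∈ F, halfLat 2 ![v, u] ≤ C) :
    ∃ J₀ : ℝ, 0 < J₀ ∧ ∀ J : ℝ, 0 < J → J ≤ J₀ → ∃ C' : ℝ, ∀ F : Finset (Site 3), (∀ c ∈ F, hh c = 0) →
      ∑ c ∈ F, twinLat J 2 ![0, c] ≤ C' := by
  obtain ⟨C, hC⟩ := hW1
  set C₁ : ℝ := max C 1 with hC₁
  have hC1 : 1 ≤ C₁ := le_max_right _ _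
  have hC0 : 0 ≤ C₁ := zero_le_one.trans hC1
  have hW : ∀ v : Site 3, hh v = -1 → ∀ F : Finset (Site 3), (∀ u ∈ F, hh u = -1) →
      ∑ u ∈ F, halfLat 2 ![v, u] ≤ C₁ := fun v hv F hF => (hC v hv F hF).trans (le_max_left _ _)
  have hβ : 0 < criticalBeta 3 := criticalBeta_pos_holds (d := 3) (by norm_num)
  have hden : 0 < 12 * criticalBeta 3 * C₁ := mul_pos (mul_pos (by norm_num) hβ) (by linarith)
  refine ⟨1 / (12 * criticalBeta 3 * C₁), div_pos one_pos hden, fun J hJ hJle => ⟨3, fun F hF => ?_⟩⟩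
  have hprod : J * (12 * criticalBeta 3 * C₁) ≤ 1 := (le_div_iff₀ hden).1 hJle
  have hbJ : 0 ≤ criticalBeta 3 * J := mul_nonneg hβ.le hJ.le
  have ht6 : 6 * (criticalBeta 3 * J) ≤ 1 / 2 := by nlinarith [mul_nonneg hbJ (sub_nonneg.2 hC1)]
  have ht3 : 3 * (criticalBeta 3 * J) * C₁ ≤ 1 / 4 := by nlinarith
  have hL : ∀ L : ℕ, ∑ c ∈ F, Gs J L 0 c ≤ 3 := fun L =>
    (sum_Gs_le_Ssum hJ.le L F hF).trans
      (Ssum_le_three hJ.le L hC0 ht6 ht3 hW ⟨0, zero_mem_box 3 L⟩ (by simp [hh]))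
  have hlim : Tendsto (fun L : ℕ => ∑ c ∈ F, Gs J L 0 c) atTop (𝓝 (∑ c ∈ F, twinLat J 2 ![0, c])) :=
    tendsto_finsetSum F fun c _ => tendsto_Gs hJ.le 0 c
  exact le_of_tendsto' hlim hL

end PlaneSummable

open Literature.Probability.LatticeModels

/-- **(W2) Seam renewal, registered form** (stub `stub_planeSummable_of_surfaceSummable` of line `seam_renewal` of crux
`TwinThreshold`): if the critical (111) half-crystal `H⁻` has finite surface susceptibility — the sums `∑_{u ∈ F} halfLat 2 ![v, u]`
over finite sets `F` of layer-`(-1)` sites are bounded by one constant `C` for every layer-`(-1)` base point `v` — then there is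
`J₀ > 0` (here `J₀ = 1 / (12 β_c(3) max(C, 1))`) such that for every seam coupling `0 < J ≤ J₀` the plane sums
`∑_{c ∈ F} twinLat J 2 ![0, c]` of the (111) reflection twin `TW(J)` at `β_c(3)` over finite sets `F` of plane sites are bounded
(by `3`). Proof: `PlaneSummable.planeSummable_of_surfaceSummable` (Lieb–Simon renewal across the weakly coupled seam in every box,
GKS volume monotonicity for the sup over boxes); the registered signature is this statement with the local definitions unfolded.
[cite: AizenmanDuminilCopinAnnals2021, Lemma 5.7] -/
theorem stub_planeSummable_of_surfaceSummable : open Literature.Probability.LatticeModels in ((fun (hZ : Site 3 → ℤ) => (fun (halfLat : (k : ℕ) → (Fin k → Site 3) → ℝ) => (fun (twinLat : ℝ → (k : ℕ) → (Fin k → Site 3) → ℝ) => (∃ C : ℝ, ∀ v : Site 3, hZ v = -1 → ∀ F : Finset (Site 3), (∀ u ∈ F, hZ u = -1) → ∑ u ∈ F, halfLat 2 ![v, u] ≤ C) → ∃ J₀ : ℝ, 0 < J₀ ∧ ∀ J : ℝ, 0 < J → J ≤ J₀ → ∃ C' : ℝ, ∀ F : Finset (Site 3), (∀ c ∈ F,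 hZ c = 0) → ∑ c ∈ F, twinLat J 2 ![0, c] ≤ C') (fun (J : ℝ) (k : ℕ) (z : Fin k → Site 3) => ⨆ L : ℕ, PairIsing.gibbsAvg (fun a b : ↥(box 3 L) => if (((∑ i, |a.1 i - b.1 i| = 1) ∧ ¬ ((a.1 0 + a.1 1 + a.1 2 = 0 ∧ b.1 0 + b.1 1 + b.1 2 = 1) ∨ (a.1 0 + a.1 1 + a.1 2 = 1 ∧ b.1 0 + b.1 1 + b.1 2 = 0))) ∨ (((a.1 0 + a.1 1 + a.1 2 = 0 ∧ b.1 0 + b.1 1 + b.1 2 = 1) ∨ (a.1 0 + a.1 1 + a.1 2 = 1 ∧ b.1 0 + b.1 1 + b.1 2 = 0)) ∧ ∃ i : Fin 3, a.1 + b.1 = Pi.single i 1)) then (criticalBeta 3 / 2) * (if a.1 0 + a.1 1 + a.1 2 = 0 ∨ b.1 0 + b.1 1 + b.1 2 = 0 then J else 1) else 0) (fun s => ∏ i, if h : z i ∈ box 3 L then spinAt (⟨z i, h⟩ : ↥(box 3 L)) s else 0))) (fun (k : ℕ) (z : Fin k → Site 3) => ⨆ L : ℕ, PairIsing.gibbsAvg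 (fun a b : ↥((box 3 L).filter (fun x : Site 3 => x 0 + x 1 + x 2 ≤ -1)) => if (∑ i, |a.1 i - b.1 i| = 1) then criticalBeta 3 / 2 else (0 : ℝ)) (fun s => ∏ i, if h : z i ∈ ((box 3 L).filter (fun x : Site 3 => x 0 + x 1 + x 2 ≤ -1)) then spinAt (⟨z i, h⟩ : ↥((box 3 L).filter (fun x : Site 3 => x 0 + x 1 + x 2 ≤ -1))) s else 0))) (fun z : Site 3 => z 0 + z 1 + z 2)) :=
  PlaneSummable.planeSummable_of_surfaceSummable

end Summit.CriticalPhenomena.Ising3DConformalLimit.Cruxes.TwinThreshold.SeamRenewal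

end
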